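import Summits.CriticalPhenomena.Ising3DConformalLimit.Theorems.HarmonicMomentsIsotropyDilutionTransferNuB1
import Summits.CriticalPhenomena.Ising3DConformalLimit.Theorems.HarmonicMomentsIsotropyDilutionTransferDoublingB

/-!
# The scaled two-point measures `ν_β`: `ξ₂ → ∞` and charging of cubes

Support file for item `DilutionTransfer` (stmt-CriticalPhenomena-6037) of route
`HarmonicMomentsIsotropy` (sub-problem `Ising3DConformalLimit`).

* `chi_le_two_mul_head`, `head_le_card` — the window tail bound leaves half the mass in the box of
  radius `A₀ ξ₂`;
* `tendsto_xi_atTop` — `ξ₂(β) → ∞` as `β ↑ β_c` (CLW (ii) + `χ → ∞`);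
* `nu_charge` — **charging**: under EX (doubling), CLW (i) at `ε = 1/2` and CLW (ii), every small
  cube away from the origin gets `ν_β`-mass `≥ ι > 0` for all `β` close to `β_c`.
-/

noncomputable section

open MeasureTheory Filter Topology Set
open scoped ENNReal NNReal BigOperators
open Literature.Probability.LatticeModels

namespace Summit.CriticalPhenomena.Ising3DConformalLimit.Theorems.HarmonicMomentsIsotropy

open scoped Classical

/-! ## Consequences of the one-length window: `χ ≤ 2 · (head)` and `ξ₂ → ∞` -/

/-- A tail scale `A₀ ≥ 1` at which the window bound is `≤ 1/2`. -/
theorem exists_tail_scale {c₀ : ℝ} (hc₀ : 0 < c₀) (C : ℝ) :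
    ∃ A₀ : ℝ, 1 ≤ A₀ ∧ C * Real.exp (-(c₀ * A₀)) ≤ 1 / 2 := by
  have h : Tendsto (fun A : ℝ => C * Real.exp (-(c₀ * A))) atTop (𝓝 (C * 0)) :=
    (Real.tendsto_exp_neg_atTop_nhds_zero.comp (tendsto_id.const_mul_atTop hc₀)).const_mul C
  rw [mul_zero] at h
  obtain ⟨A₀, h1, h2⟩ := ((h.eventually (Iic_mem_nhds (by norm_num : (0 : ℝ) < 1 / 2))).and
    (eventually_ge_atTop 1)).exists
  exact ⟨A₀, h2, h1⟩

/-- The complement of the tail region lies in a lattice box: if `¬(A² M₂ < |x|² χ)` then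
`‖x‖_∞ ≤ A ξ₂`. -/
theorem norm_le_of_not_tail {β : ℝ} (hβ : 0 < β) (hβc : β < criticalBeta 3) {A : ℝ} (hA : 0 ≤ A)
    {x : Site 3} (hx : ¬(A ^ 2 * msq β < (∑ i, ((x i : ℤ) : ℝ) ^ 2) * chi β)) :
    ‖x‖ ≤ A * xi β := by
  have hξ := xi_pos hβ hβc
  rw [← lt_norm_smul_siteV_iff hβ hβc hA x, not_lt, norm_smul, Real.norm_eq_abs,
    abs_of_pos (inv_pos.2 hξ), ← div_eq_inv_mul, div_le_iff₀ hξ] at hx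
  exact (norm_le_norm_siteV x).trans hx

/-- **`χ(β) ≤ 2 ∑_{x ∉ tail(A₀)} G_β(x)`** once the tail bound at scale `A₀` is `≤ 1/2`. -/
theorem chi_le_two_mul_head {β A₀ C c₀ : ℝ} (hβ : 0 < β) (hβc : β < criticalBeta 3)
    (htail : (∑' x : Site 3, if A₀ ^ 2 * msq β < (∑ i, ((x i : ℤ) : ℝ) ^ 2) * chi β
        then twoPointFree 3 β x else 0) ≤ C * Real.exp (-(c₀ * A₀)) * chi β)
    (hA₀ : C * Real.exp (-(c₀ * A₀)) ≤ 1 / 2) :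
    chi β ≤ 2 * ∑' x : Site 3, (if ¬(A₀ ^ 2 * msq β < (∑ i, ((x i : ℤ) : ℝ) ^ 2) * chi β)
      then twoPointFree 3 β x else 0) := by
  have hχ := chi_pos hβ.le hβc
  have hsplit : chi β = (∑' x : Site 3, if A₀ ^ 2 * msq β < (∑ i, ((x i : ℤ) : ℝ) ^ 2) * chi β
      then twoPointFree 3 β x else 0) + ∑' x : Site 3, (if ¬(A₀ ^ 2 * msq β <
        (∑ i, ((x i : ℤ) : ℝ) ^ 2) * chi β) then twoPointFree 3 β x else 0) := by
    have hc : chi β = ∑' x : Site 3, twoPointFree 3 β x := rfl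
    conv_lhs => rw [hc]
    rw [← Summable.tsum_add (summable_ite_G hβ.le hβc _) (summable_ite_G hβ.le hβc _)]
    refine tsum_congr fun x => ?_
    by_cases h : A₀ ^ 2 * msq β < (∑ i, ((x i : ℤ) : ℝ) ^ 2) * chi β
    · rw [if_pos h, if_neg (not_not.2 h), add_zero]
    · rw [if_neg h, if_pos h, zero_add]
  have h1 : C * Real.exp (-(c₀ * A₀)) * chi β ≤ 1 / 2 * chi β :=
    mul_le_mul_of_nonneg_right hA₀ hχ.le
  linarith

/-- The head sum is at most the number of lattice points in the box of radius `A ξ₂`: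
`∑_{x ∉ tail(A)} G_β(x) ≤ (2⌊Aξ₂⌋ + 1)³`. -/
theorem head_le_card {β : ℝ} (hβ : 0 < β) (hβc : β < criticalBeta 3) {A : ℝ} (hA : 0 ≤ A) :
    (∑' x : Site 3, if ¬(A ^ 2 * msq β < (∑ i, ((x i : ℤ) : ℝ) ^ 2) * chi β)
      then twoPointFree 3 β x else 0) ≤ (2 * (⌊A * xi β⌋₊ : ℝ) + 1) ^ 3 := by
  set N : ℕ := ⌊A * xi β⌋₊ with hN
  have hbox : ∀ x : Site 3, ¬(A ^ 2 * msq β < (∑ i, ((x i : ℤ) : ℝ) ^ 2) * chi β) → x ∈ box 3 N := by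
    intro x hx
    have hn := norm_le_of_not_tail hβ hβc hA hx
    rw [mem_box]
    intro i
    have hi : |((x i : ℤ) : ℝ)| ≤ A * xi β := by
      have := norm_le_pi_norm x i
      rw [Int.norm_eq_abs] at this
      exact this.trans hn
    have hiN : (x i).natAbs ≤ N := by
      rw [hN]
      refine Nat.le_floor ?_
      rw [Nat.cast_natAbs, Int.cast_abs]
      exact hi
    constructor <;> omega
  calc (∑' x : Site 3, if ¬(A ^ 2 * msq β < (∑ i, ((x i : ℤ) : ℝ) ^ 2) * chi β)
        then twoPointFree 3 β x else 0)
      ≤ ∑' x : Site 3, (if x ∈ box 3 N then (1 : ℝ) else 0) := by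
        refine tsum_ite_le_tsum_ite hbox (fun x => IsingInputs.G_nonneg hβ.le x)
          (fun x _ => IsingInputs.G_le_one hβ.le x) (fun _ => zero_le_one) ?_
        refine summable_of_hasFiniteSupport ((box 3 N).finite_toSet.subset fun x hx => ?_)
        rw [Function.mem_support] at hx
        by_contra h
        exact hx (if_neg h)
    _ = ∑ x ∈ box 3 N, (if x ∈ box 3 N then (1 : ℝ) else 0) := by
        refine tsum_eq_sum fun x hx => ?_
        rw [if_neg hx]
    _ = (box 3 N).card := by
        rw [Finset.sum_ite_mem, Finset.inter_self, Finset.sum_const, nsmul_eq_mul, mul_one]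
    _ = (2 * (N : ℝ) + 1) ^ 3 := by
        rw [card_box]; push_cast; ring

/-- **`ξ₂(β) → ∞` as `β ↑ β_c`**, from the one-length window (CLW (ii)) and `χ(β) → ∞`. -/
theorem tendsto_xi_atTop {c₀ C β₀ : ℝ} (hc₀ : 0 < c₀) (hβ₀ : β₀ < criticalBeta 3)
    (hii : ∀ β : ℝ, β₀ ≤ β → β < criticalBeta 3 → ∀ A : ℝ, 1 ≤ A →
      (∑' x : Site 3, if A ^ 2 * msq β < (∑ i, ((x i : ℤ) : ℝ) ^ 2) * chi β
        then twoPointFree 3 β x else 0) ≤ C * Real.exp (-(c₀ * A)) * chi β) :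
    Tendsto xi (𝓝[<] (criticalBeta 3)) atTop := by
  obtain ⟨A₀, hA₀1, hA₀⟩ := exists_tail_scale hc₀ C
  have hA₀0 : 0 ≤ A₀ := zero_le_one.trans hA₀1
  have hgood : ∀ᶠ β in 𝓝[<] (criticalBeta 3), max β₀ 0 < β ∧ β < criticalBeta 3 := by
    have : Ioo (max β₀ 0) (criticalBeta 3) ∈ 𝓝[<] (criticalBeta 3) :=
      Ioo_mem_nhdsLT (max_lt hβ₀ (criticalBeta_pos_holds (d := 3) (by norm_num)))
    filter_upwards [this] with β hβ using hβ
  rw [tendsto_atTop]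
  intro M
  have hχ := IsingInputs.tendsto_tsum_G_atTop
  rw [tendsto_atTop] at hχ
  filter_upwards [hgood, hχ (2 * (2 * (A₀ * |M|) + 1) ^ 3 + 1)] with β hβ hχβ
  have hβ0 : 0 < β := lt_of_le_of_lt (le_max_right _ _) hβ.1
  have hββ₀ : β₀ ≤ β := (le_max_left _ _).trans hβ.1.le
  have h1 := chi_le_two_mul_head hβ0 hβ.2 (hii β hββ₀ hβ.2 A₀ hA₀1) hA₀
  have h2 := head_le_card hβ0 hβ.2 hA₀0 (A := A₀)
  have h3 : (⌊A₀ * xi β⌋₊ : ℝ) ≤ A₀ * xi β := Nat.floor_le (by positivity [xi_nonneg β])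
  have hchi : chi β = ∑' x : Site 3, twoPointFree 3 β x := rfl
  rw [← hchi] at hχβ
  -- `(2 A₀ |M| + 1)³ < (2 A₀ ξ + 1)³`
  have h4 : (2 * (⌊A₀ * xi β⌋₊ : ℝ) + 1) ^ 3 ≤ (2 * (A₀ * xi β) + 1) ^ 3 :=
    pow_le_pow_left₀ (by positivity) (by linarith) 3
  have hlt : (2 * (A₀ * |M|) + 1) ^ 3 < (2 * (A₀ * xi β) + 1) ^ 3 := by linarith
  have hlt' : 2 * (A₀ * |M|) + 1 < 2 * (A₀ * xi β) + 1 :=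
    lt_of_pow_lt_pow_left₀ 3 (by positivity [xi_nonneg β]) hlt
  have hA₀pos : 0 < A₀ := lt_of_lt_of_le one_pos hA₀1
  have : |M| < xi β := by nlinarith
  exact (le_abs_self M).trans this.le

/-! ## Charging: `ν_β` gives uniformly positive mass to small cubes away from the origin -/

/-- **The scaled two-point measures charge cubes away from the origin.** Under a
scale-covariant non-degenerate pointwise scaling limit of the critical correlators (EX), the
critical window CLW (i) at `ε = 1/2` (scale `s₁`, from `β₁`) and the one-length window CLW (ii)
(from `β₀`), every cube `{‖z - w‖_∞ ≤ r}` with `r + η < ‖w‖_∞` and `9(‖w‖_∞ + r)² ≤ s₁` receives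
`ν_β`-mass at least a fixed `ι > 0` for all `β` close to `β_c`. -/
theorem nu_charge {ρ : ℝ → ℝ} {Δ : ℝ} {S : CorrFamily 3}
    (hρ : ∀ δ ∈ Set.Ioc (0 : ℝ) 1, 0 < ρ δ)
    (hlim : HasPointwiseScalingLimit (criticalCorr 3) ρ S) (hsc : IsScaleCovariant Δ S)
    (hnd : IsNondegenerateTwoPoint S)
    {s₁ β₁ : ℝ} (hβ₁ : β₁ < criticalBeta 3)
    (hi : ∀ β : ℝ, β₁ ≤ β → β < criticalBeta 3 → ∀ x : Site 3,
      (∑ i, ((x i : ℤ) : ℝ) ^ 2) * chi β ≤ s₁ * msq β →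
        (1 / 2 : ℝ) * criticalTwoPoint 3 x ≤ twoPointFree 3 β x)
    {c₀ C β₀ : ℝ} (hc₀ : 0 < c₀) (hβ₀ : β₀ < criticalBeta 3)
    (hii : ∀ β : ℝ, β₀ ≤ β → β < criticalBeta 3 → ∀ A : ℝ, 1 ≤ A →
      (∑' x : Site 3, if A ^ 2 * msq β < (∑ i, ((x i : ℤ) : ℝ) ^ 2) * chi β
        then twoPointFree 3 β x else 0) ≤ C * Real.exp (-(c₀ * A)) * chi β)
    (w : Fin 3 → ℝ) {r η : ℝ} (hr : 0 < r) (hη : 0 < η) (hw : r + η < ‖w‖)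
    (hws : 9 * (‖w‖ + r) ^ 2 ≤ s₁) :
    ∃ ι > 0, ∀ᶠ β in 𝓝[<] (criticalBeta 3),
      ι ≤ ((nu β) {y | WithLp.ofLp y ∈ Metric.closedBall w r}).toReal := by
  obtain ⟨A₀, hA₀1, hA₀⟩ := exists_tail_scale hc₀ C
  have hA₀pos : 0 < A₀ := lt_of_lt_of_le one_pos hA₀1
  -- the doubling constant for the rescaled cube
  set w' : Fin 3 → ℝ := A₀⁻¹ • w with hw'
  have hnw' : ‖w'‖ = A₀⁻¹ * ‖w‖ := by
    rw [hw', norm_smul, Real.norm_eq_abs, abs_of_pos (inv_pos.2 hA₀pos)]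
  obtain ⟨q, hq, δq, hδq, hdoub⟩ := LatticeSums.cubeSum_ge_mul_ballSum hρ hlim hsc hnd w'
    (r := r / A₀) (η := η / A₀) (by positivity) (by positivity) (by
      rw [hnw', ← add_div, div_lt_iff₀ hA₀pos]
      calc r + η < ‖w‖ := hw
        _ = A₀⁻¹ * ‖w‖ * A₀ := by field_simp)
  refine ⟨q / 4, by positivity, ?_⟩
  -- good `β`: close to `β_c` and `ξ₂` large
  have hξ := tendsto_xi_atTop hc₀ hβ₀ hii
  have hgood : ∀ᶠ β in 𝓝[<] (criticalBeta 3), max (max β₀ β₁) 0 < β ∧ β < criticalBeta 3 := by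
    have : Ioo (max (max β₀ β₁) 0) (criticalBeta 3) ∈ 𝓝[<] (criticalBeta 3) :=
      Ioo_mem_nhdsLT (max_lt (max_lt hβ₀ hβ₁) (criticalBeta_pos_holds (d := 3) (by norm_num)))
    filter_upwards [this] with β hβ using hβ
  filter_upwards [hgood, hξ.eventually_gt_atTop ((A₀ * δq)⁻¹)] with β hβ hξβ
  have hβ0 : 0 < β := lt_of_le_of_lt (le_max_right _ _) hβ.1
  have hβc : β < criticalBeta 3 := hβ.2
  have hββ₀ : β₀ ≤ β := ((le_max_left _ _).trans (le_max_left _ _)).trans hβ.1.le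
  have hββ₁ : β₁ ≤ β := ((le_max_right _ _).trans (le_max_left _ _)).trans hβ.1.le
  have hχ := chi_pos hβ0.le hβc
  have hξpos := xi_pos hβ0 hβc
  set ξ : ℝ := xi β with hξdef
  set δ : ℝ := (A₀ * ξ)⁻¹ with hδ
  have hδpos : 0 < δ := by positivity
  have hδq' : δ < δq := by
    rw [hδ, inv_lt_comm₀ (by positivity) hδq]
    calc δq⁻¹ = (A₀ * δq)⁻¹ * A₀ := by field_simp
      _ < ξ * A₀ := mul_lt_mul_of_pos_right hξβ hA₀pos
      _ = A₀ * ξ := mul_comm _ _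
  -- (1) the measure of the cube as a lattice sum
  have hmeas : ((nu β) {y | WithLp.ofLp y ∈ Metric.closedBall w r}).toReal = (chi β)⁻¹ *
      ∑' x : Site 3, (if ξ⁻¹ • siteW x ∈ Metric.closedBall w r then twoPointFree 3 β x else 0) := by
    rw [nu_apply_toReal hβ0.le hβc, ENNReal.toReal_ofReal]
    · congr 1
    · exact mul_nonneg (inv_nonneg.2 hχ.le) (tsum_nonneg fun x => by
        split_ifs; exacts [IsingInputs.G_nonneg hβ0.le x, le_refl _])
  -- (2) CLW (i): on the cube, `G_β ≥ G_c/2`; and the cube condition at mesh `δ`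
  have hcube_iff : ∀ x : Site 3, ξ⁻¹ • siteW x ∈ Metric.closedBall w r ↔
      (δ • fun i => ((x i : ℤ) : ℝ)) ∈ Metric.closedBall w' (r / A₀) := by
    intro x
    have hsw : siteW x = fun i => ((x i : ℤ) : ℝ) := rfl
    rw [Metric.mem_closedBall, Metric.mem_closedBall, dist_eq_norm, dist_eq_norm, hw', hδ, ← hsw,
      show (A₀ * ξ)⁻¹ • siteW x - A₀⁻¹ • w = A₀⁻¹ • (ξ⁻¹ • siteW x - w) by
        rw [smul_sub, smul_smul, mul_inv], norm_smul, Real.norm_eq_abs,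
      abs_of_pos (inv_pos.2 hA₀pos), ← div_eq_inv_mul, div_le_div_iff_of_pos_right hA₀pos]
  have hlow : (∑' x : Site 3, if (δ • fun i => ((x i : ℤ) : ℝ)) ∈ Metric.closedBall w' (r / A₀)
      then (1 / 2 : ℝ) * criticalTwoPoint 3 x else 0) ≤
      ∑' x : Site 3, (if ξ⁻¹ • siteW x ∈ Metric.closedBall w r then twoPointFree 3 β x else 0) := by
    refine tsum_ite_le_tsum_ite (fun x hx => (hcube_iff x).2 hx)
      (fun x => by positivity [criticalTwoPoint_nonneg' x]) (fun x hx => ?_)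
      (fun x => IsingInputs.G_nonneg hβ0.le x) (summable_ite_G hβ0.le hβc _)
    refine hi β hββ₁ hβc x ?_
    -- `|x|² χ ≤ 9(‖w‖+r)² M₂ ≤ s₁ M₂`
    have hx' := (hcube_iff x).2 hx
    rw [Metric.mem_closedBall, dist_eq_norm] at hx'
    have hn1 : ‖ξ⁻¹ • siteW x‖ ≤ ‖w‖ + r := by
      have := norm_le_norm_sub_add (ξ⁻¹ • siteW x) w
      linarith [norm_sub_rev (ξ⁻¹ • siteW x) w]
    have hn2 : ‖x‖ ≤ (‖w‖ + r) * ξ := by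
      rw [norm_smul, Real.norm_eq_abs, abs_of_pos (inv_pos.2 hξpos), ← div_eq_inv_mul,
        div_le_iff₀ hξpos] at hn1
      have : ‖siteW x‖ = ‖x‖ := LatticeSums.norm_intCast_eq x
      linarith [this ▸ hn1]
    have hr2 : (∑ i, ((x i : ℤ) : ℝ) ^ 2) ≤ 9 * ((‖w‖ + r) * ξ) ^ 2 := by
      rw [← norm_siteV_sq]
      have h9 : ‖siteV x‖ ≤ 3 * ((‖w‖ + r) * ξ) := (norm_siteV_le x).trans (by linarith)
      nlinarith [norm_nonneg (siteV x)]
    have hξ2 : ξ ^ 2 * chi β = msq β := by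
      rw [hξdef, xi_sq hβ0.le hβc]; field_simp
    calc (∑ i, ((x i : ℤ) : ℝ) ^ 2) * chi β ≤ 9 * ((‖w‖ + r) * ξ) ^ 2 * chi β :=
          mul_le_mul_of_nonneg_right hr2 hχ.le
      _ = 9 * (‖w‖ + r) ^ 2 * (ξ ^ 2 * chi β) := by ring
      _ ≤ s₁ * msq β := by rw [hξ2]; exact mul_le_mul_of_nonneg_right hws (msq_nonneg hβ0.le)
  have hlow' : (∑' x : Site 3, if (δ • fun i => ((x i : ℤ) : ℝ)) ∈ Metric.closedBall w' (r / A₀)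
      then (1 / 2 : ℝ) * criticalTwoPoint 3 x else 0) = 1 / 2 * ∑' x : Site 3,
        (if (δ • fun i => ((x i : ℤ) : ℝ)) ∈ Metric.closedBall w' (r / A₀)
          then criticalTwoPoint 3 x else 0) := by
    rw [← tsum_mul_left]; refine tsum_congr fun x => ?_; split_ifs <;> ring
  -- (3) doubling at mesh `δ`
  have hd := hdoub δ hδpos hδq'
  -- (4) the ball sum dominates the head sum, which is `≥ χ/2`
  have hhead : (∑' x : Site 3, if ¬(A₀ ^ 2 * msq β < (∑ i, ((x i : ℤ) : ℝ) ^ 2) * chi β)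
      then twoPointFree 3 β x else 0) ≤
      ∑' x : Site 3, (if (δ • fun i => ((x i : ℤ) : ℝ)) ∈ Metric.closedBall (0 : Fin 3 → ℝ) 1
        then criticalTwoPoint 3 x else 0) := by
    refine tsum_ite_le_tsum_ite (fun x hx => ?_) (fun x => IsingInputs.G_nonneg hβ0.le x)
      (fun x _ => IsingInputs.G_le_critical hβ0.le hβc.le x) (fun x => criticalTwoPoint_nonneg' x)
      (LatticeSums.summable_norm_ite_mem hδpos subset_rfl _).of_norm
    have hn := norm_le_of_not_tail hβ0 hβc (zero_le_one.trans hA₀1) hx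
    rw [Metric.mem_closedBall, dist_zero_right, norm_smul, Real.norm_eq_abs, abs_of_pos hδpos,
      LatticeSums.norm_intCast_eq, hδ, ← div_eq_inv_mul, div_le_one (by positivity)]
    exact hn
  have hchi2 := chi_le_two_mul_head hβ0 hβc (hii β hββ₀ hβc A₀ hA₀1) hA₀
  -- (5) assemble: `ν(cube) ≥ χ⁻¹ · (1/2) · q · ballSum ≥ q/4`
  rw [hmeas]
  have hball_ge : chi β / 2 ≤ ∑' x : Site 3, (if (δ • fun i => ((x i : ℤ) : ℝ)) ∈
      Metric.closedBall (0 : Fin 3 → ℝ) 1 then criticalTwoPoint 3 x else 0) := by linarith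
  have key : q / 4 * chi β ≤ ∑' x : Site 3,
      (if ξ⁻¹ • siteW x ∈ Metric.closedBall w r then twoPointFree 3 β x else 0) := by
    calc q / 4 * chi β = 1 / 2 * (q * (chi β / 2)) := by ring
      _ ≤ 1 / 2 * (q * ∑' x : Site 3, (if (δ • fun i => ((x i : ℤ) : ℝ)) ∈
          Metric.closedBall (0 : Fin 3 → ℝ) 1 then criticalTwoPoint 3 x else 0)) := by
          gcongr
      _ ≤ 1 / 2 * ∑' x : Site 3, (if (δ • fun i => ((x i : ℤ) : ℝ)) ∈
          Metric.closedBall w' (r / A₀) then criticalTwoPoint 3 x else 0) := by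
          gcongr
      _ ≤ _ := by rw [← hlow']; exact hlow
  rw [le_inv_mul_iff₀ hχ]
  linarith

end Summit.CriticalPhenomena.Ising3DConformalLimit.Theorems.HarmonicMomentsIsotropy

end
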